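import Summits.BirchSwinnertonDyer.BirchSwinnertonDyer.Theorems.ByReductionTypeAtTwoMultTowerNS2LayerNormGroup
import Summits.BirchSwinnertonDyer.BirchSwinnertonDyer.Theorems.ByReductionTypeAtTwoMultTowerNS2LocalLayerField
import Literature.NumberTheory.GaloisRepresentations.LocalNormIndex
import HarnessLib

/-!
# Route `ByReductionTypeAtTwo`, crux `MultUpperHalfAtTwo` (item stmt-BirchSwinnertonDyer-19922), TOWER road, the
# «ONE BIT AT A NON-SPLIT 2» rows: KERNEL BRICK 17 — the CLASS FIELD AXIOM for the quadratic layer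
# `K̄_v^{H_n ∩ Stab(t)} / F_n`: among three elements of `F_nˣ` two are congruent modulo norms `f · τ₀ f`

HONEST FRAMING (cell `bsd-2adic`, run/shared/lean/pub/bsd-2adic/, seat `bsd-2adic-tower-1` GEN 9, HUMAN RULINGS
D-0036 / D-0054 / D-0074): TOOL theorems only (no definition, no named fact, no `sorry`); closes nothing by itself;
nothing booked; BSD is not proved by any of this. Module M7 (input `hN2` of BRICK 16d) of the KERNELISATION of the
MEMO binder `MultTowerNS2.localTowerKerTwoTorsion_le_two_nonsplitTwo_of_tateUnit` (scope memo
HOME/tower/SCOPE-hNS2one-kernel-GEN8.md). Setting: `ℚ_v = v.adicCompletion ℚ`, `Γ = Gal(K̄_v/ℚ_v)`, `H_n` the local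
layer subgroup of the cyclotomic `ℤ₂`-tower, `t ∈ K̄_v` with `σ t = ± t` for all `σ ∈ Γ`, `τ₀ ∈ H_n` with `τ₀ t = −t`.
Then `D = H_n ∩ Stab(t)` is an open normal subgroup of index `2` in `H_n`, its fixed field `L₀ = K̄_v^D` is a
quadratic Galois extension of `F_n = K̄_v^{H_n}` with group `{1, τ₀|_{L₀}}` and norm `N(f) = f · τ₀ f`, and the tree's
PROVED local class field axiom (Neukirch V (1.1), `normIndex_eq_finrank_of_isNonarchimedeanLocalField`) gives
`[F_nˣ : N L₀ˣ] = 2`; by pigeonhole, among any three non-zero `H_n`-invariant `c₁, c₂, c₃` two differ by a norm.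

* `stabilizer_normal`, `isOpen_stabilizer`, `neg_ne_self_of_ne_zero`, `relIndex_inf_stabilizer_eq_two` — group
  theoretic preliminaries;
* `exists_norm_rel_of_three` — the statement, in exactly the shape of hypothesis `hN2` of
  `exists_div_eq_zpow_mul_coboundary_of_three` (BRICK 16d).

References: J. Neukirch, *Algebraic Number Theory*, Ch. V §1 Thm. (1.1); Ch. IV §1; R. Greenberg, LNM 1716 §3.
-/

set_option autoImplicit false
-- the Theorems namespace of this sub repeats the summit name by design (D-0017 nested layout: Summit.<S>.<Sub>)
set_option linter.dupNamespace false

noncomputable section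

open scoped Classical IntermediateField

namespace Summit.BirchSwinnertonDyer.BirchSwinnertonDyer.Theorems.MultTowerNS2

open NumberField IsDedekindDomain Field Literature.NumberTheory.EllipticCurves
  Literature.NumberTheory.GaloisRepresentations

variable {κ : ZpExtension ℚ 2}

/-! ### The subgroup `H_n ∩ Stab(t)` -/

/-- The stabiliser in `Γ_{ℚ_v}` of an element `t` with `σ t = ± t` for every `σ` is a normal subgroup. [folklore] -/
theorem stabilizer_normal (v : HeightOneSpectrum (𝓞 ℚ)) {t : AlgebraicClosure (v.adicCompletion ℚ)}
    (ht : ∀ σ : absoluteGaloisGroup (v.adicCompletion ℚ), σ • t = t ∨ σ • t = -t) :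
    (MulAction.stabilizer (absoluteGaloisGroup (v.adicCompletion ℚ)) t).Normal := by
  refine ⟨fun h hh σ ↦ ?_⟩
  rw [MulAction.mem_stabilizer_iff] at hh ⊢
  have hσ' : σ • σ⁻¹ • t = t := smul_inv_smul σ t
  rcases ht σ⁻¹ with h1 | h1
  · rw [h1] at hσ'
    rw [mul_smul, mul_smul, h1, hh]
    exact hσ'
  · rw [h1] at hσ'
    rw [mul_smul, mul_smul, h1, smul_neg, hh]
    exact hσ'

/-- The stabiliser of an element of `K̄_v` in `Γ_{ℚ_v}` is open (it contains the open subgroup `Gal(K̄_v/ℚ_v(t))`).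
[folklore] -/
theorem isOpen_stabilizer (v : HeightOneSpectrum (𝓞 ℚ)) (t : AlgebraicClosure (v.adicCompletion ℚ)) :
    IsOpen (MulAction.stabilizer (absoluteGaloisGroup (v.adicCompletion ℚ)) t :
      Set (absoluteGaloisGroup (v.adicCompletion ℚ))) := by
  have hint : IsIntegral (v.adicCompletion ℚ) t := Algebra.IsIntegral.isIntegral t
  haveI : FiniteDimensional (v.adicCompletion ℚ) (v.adicCompletion ℚ)⟮t⟯ := IntermediateField.adjoin.finiteDimensional hint
  refine Subgroup.isOpen_mono ?_ (IntermediateField.fixingSubgroup_isOpen (v.adicCompletion ℚ)⟮t⟯)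
  intro σ hσ
  exact MulAction.mem_stabilizer_iff.mpr
    ((IntermediateField.mem_fixingSubgroup_iff _ _).mp hσ t (IntermediateField.mem_adjoin_simple_self _ t))

/-- `−t ≠ t` for `t ≠ 0` in `K̄_v` (characteristic `0`). [folklore] -/
theorem neg_ne_self_of_ne_zero (v : HeightOneSpectrum (𝓞 ℚ)) {t : AlgebraicClosure (v.adicCompletion ℚ)}
    (ht0 : t ≠ 0) : -t ≠ t := by
  haveI : CharZero (v.adicCompletion ℚ) :=
    charZero_of_injective_algebraMap (algebraMap ℚ (v.adicCompletion ℚ)).injective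
  haveI : CharZero (AlgebraicClosure (v.adicCompletion ℚ)) :=
    charZero_of_injective_algebraMap (algebraMap (v.adicCompletion ℚ) (AlgebraicClosure (v.adicCompletion ℚ))).injective
  intro h
  have h2 : (2 : AlgebraicClosure (v.adicCompletion ℚ)) * t = 0 := by linear_combination -h
  exact ht0 ((mul_eq_zero.mp h2).resolve_left two_ne_zero)

/-- **`[H : H ∩ Stab(t)] = 2`** whenever `H ≤ Γ_{ℚ_v}` contains an element `τ₀` flipping `t ≠ 0` (`σ t = ± t` for all
`σ`): `b ↦ b τ₀` exchanges `H ∩ Stab(t)` and its complement in `H`. [folklore] -/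
theorem relIndex_inf_stabilizer_eq_two (v : HeightOneSpectrum (𝓞 ℚ)) {t : AlgebraicClosure (v.adicCompletion ℚ)}
    (ht : ∀ σ : absoluteGaloisGroup (v.adicCompletion ℚ), σ • t = t ∨ σ • t = -t) (ht0 : t ≠ 0)
    {H : Subgroup (absoluteGaloisGroup (v.adicCompletion ℚ))} {τ₀ : absoluteGaloisGroup (v.adicCompletion ℚ)}
    (hτ₀ : τ₀ ∈ H) (hτ₀t : τ₀ • t = -t) :
    (H ⊓ MulAction.stabilizer (absoluteGaloisGroup (v.adicCompletion ℚ)) t).relIndex H = 2 := by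
  have hne := neg_ne_self_of_ne_zero v ht0
  rw [Subgroup.relIndex_eq_two_iff]
  refine ⟨τ₀, hτ₀, fun b hb ↦ ?_⟩
  rw [Subgroup.mem_inf, Subgroup.mem_inf, MulAction.mem_stabilizer_iff, MulAction.mem_stabilizer_iff, mul_smul, hτ₀t,
    smul_neg]
  rcases ht b with h | h
  · rw [h]
    exact Or.inr ⟨⟨hb, rfl⟩, fun h' ↦ hne h'.2⟩
  · rw [h, neg_neg]
    exact Or.inl ⟨⟨H.mul_mem hb hτ₀, rfl⟩, fun h' ↦ hne h'.2⟩

/-! ### The class field axiom for the quadratic layer, in «three elements, two congruent» form -/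

/-- **Among three elements of `F_nˣ`, two are congruent modulo norms from `L₀ = K̄_v^{H_n ∩ Stab(t)}`.** Let `v ∋ 2`,
`κ` cyclotomic, `H_n = localSubgroup (κ.layerSubgroup n) ℚ_v`, `t ∈ K̄_v`, `t ≠ 0`, with `σ t = ± t` for all
`σ ∈ Γ_{ℚ_v}`, and `τ₀ ∈ H_n` with `τ₀ t = −t`. For any three non-zero `H_n`-invariant `c₁, c₂, c₃ ∈ K̄_v` there is a
non-zero `f₀`, fixed by `H_n ∩ Stab(t)`, with `c₁ = f₀·τ₀f₀·c₂` or `c₁ = f₀·τ₀f₀·c₃` or `c₂ = f₀·τ₀f₀·c₃`. Proof: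
`D = H_n ∩ Stab(t)` is open, normal, of index `2` in `H_n`; `L₀ = K̄_v^D` is Galois over `ℚ_v` (Krull), hence over
`F_n = K̄_v^{H_n}`, of degree `[Γ : D]/[Γ : H_n] = 2`, so cyclic with group `{1, τ₀|_{L₀}}` and `N(f) = f·τ₀f`; the
local class field axiom `[F_nˣ : N L₀ˣ] = [L₀ : F_n] = 2` (Neukirch V (1.1), the tree's
`normIndex_eq_finrank_of_isNonarchimedeanLocalField`) and pigeonhole in the quotient of order `2`.
[cite: NeukirchANT1999, Ch. V §1 Thm. (1.1)] -/
theorem exists_norm_rel_of_three (hκ : κ.IsCyclotomic) (v : HeightOneSpectrum (𝓞 ℚ))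
    (hv : ((2 : ℕ) : 𝓞 ℚ) ∈ v.asIdeal) (n : ℕ) {t : AlgebraicClosure (v.adicCompletion ℚ)}
    (ht : ∀ σ : absoluteGaloisGroup (v.adicCompletion ℚ), σ • t = t ∨ σ • t = -t) (ht0 : t ≠ 0)
    {τ₀ : absoluteGaloisGroup (v.adicCompletion ℚ)}
    (hτ₀ : τ₀ ∈ localSubgroup (κ.layerSubgroup n) (v.adicCompletion ℚ)) (hτ₀t : τ₀ • t = -t)
    (c₁ c₂ c₃ : AlgebraicClosure (v.adicCompletion ℚ)) (h₁ : c₁ ≠ 0) (h₂ : c₂ ≠ 0) (h₃ : c₃ ≠ 0)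
    (hc₁ : ∀ h ∈ localSubgroup (κ.layerSubgroup n) (v.adicCompletion ℚ), h • c₁ = c₁)
    (hc₂ : ∀ h ∈ localSubgroup (κ.layerSubgroup n) (v.adicCompletion ℚ), h • c₂ = c₂)
    (hc₃ : ∀ h ∈ localSubgroup (κ.layerSubgroup n) (v.adicCompletion ℚ), h • c₃ = c₃) :
    ∃ f₀ : AlgebraicClosure (v.adicCompletion ℚ), f₀ ≠ 0 ∧
      (∀ h ∈ localSubgroup (κ.layerSubgroup n) (v.adicCompletion ℚ), h • t = t → h • f₀ = f₀) ∧
      (c₁ = f₀ * τ₀ • f₀ * c₂ ∨ c₁ = f₀ * τ₀ • f₀ * c₃ ∨ c₂ = f₀ * τ₀ • f₀ * c₃) := by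
  -- the groups (all terms mentioning `localSubgroup` are built BEFORE a `CharZero ℚ_v` instance enters the context)
  set Hn : Subgroup (absoluteGaloisGroup (v.adicCompletion ℚ)) := localSubgroup (κ.layerSubgroup n) (v.adicCompletion ℚ)
    with hHn
  have hopenHn : IsOpen (Hn : Set (absoluteGaloisGroup (v.adicCompletion ℚ))) :=
    isOpen_localSubgroup (κ.layerSubgroup n) (κ.isOpen_layerSubgroup n) (v.adicCompletion ℚ)
  have hnormHn : Hn.Normal := by
    rw [hHn, localSubgroup_eq_comap]; exact Subgroup.Normal.comap inferInstance _
  have hidxHn : Hn.index = 2 ^ n := index_localSubgroup_layerSubgroup hκ v hv n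
  set St : Subgroup (absoluteGaloisGroup (v.adicCompletion ℚ)) :=
    MulAction.stabilizer (absoluteGaloisGroup (v.adicCompletion ℚ)) t with hSt
  have hopenSt : IsOpen (St : Set (absoluteGaloisGroup (v.adicCompletion ℚ))) := isOpen_stabilizer v t
  have hnormSt : St.Normal := stabilizer_normal v ht
  set D : Subgroup (absoluteGaloisGroup (v.adicCompletion ℚ)) := Hn ⊓ St with hD
  have hopenD : IsOpen (D : Set (absoluteGaloisGroup (v.adicCompletion ℚ))) := hopenHn.inter hopenSt
  have hnormD : D.Normal := by
    haveI := hnormHn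
    haveI := hnormSt
    exact Subgroup.normal_inf_normal Hn St
  have hDle : D ≤ Hn := inf_le_left
  have hrel : D.relIndex Hn = 2 := relIndex_inf_stabilizer_eq_two v ht ht0 hτ₀ hτ₀t
  have hidxD : D.index = 2 * 2 ^ n := by rw [← Subgroup.relIndex_mul_index hDle, hrel, hidxHn]
  have memD : ∀ {h : absoluteGaloisGroup (v.adicCompletion ℚ)}, h ∈ D ↔ h ∈ Hn ∧ h • t = t := fun {h} ↦ by
    rw [hD, Subgroup.mem_inf, hSt, MulAction.mem_stabilizer_iff]
  have hne := neg_ne_self_of_ne_zero v ht0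
  -- (`CharZero ℚ_v` from here on)
  haveI : CharZero (v.adicCompletion ℚ) :=
    charZero_of_injective_algebraMap (algebraMap ℚ (v.adicCompletion ℚ)).injective
  -- the fields `F_n = K̄^{H_n} ≤ L₀ = K̄^D`
  set K₀ : IntermediateField (v.adicCompletion ℚ) (AlgebraicClosure (v.adicCompletion ℚ)) :=
    IntermediateField.fixedField Hn with hK₀
  set L₀ : IntermediateField (v.adicCompletion ℚ) (AlgebraicClosure (v.adicCompletion ℚ)) :=
    IntermediateField.fixedField D with hL₀
  have memK : ∀ {x : AlgebraicClosure (v.adicCompletion ℚ)}, x ∈ K₀ ↔ ∀ h ∈ Hn, h • x = x := fun {x} ↦ by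
    rw [hK₀, IntermediateField.mem_fixedField_iff]; rfl
  have memL : ∀ {x : AlgebraicClosure (v.adicCompletion ℚ)}, x ∈ L₀ ↔ ∀ h ∈ Hn, h • t = t → h • x = x :=
    fun {x} ↦ by
      rw [hL₀, IntermediateField.mem_fixedField_iff]
      exact ⟨fun H h hh hht ↦ H h (memD.mpr ⟨hh, hht⟩), fun H h hh ↦ H h (memD.mp hh).1 (memD.mp hh).2⟩
  have hKL : K₀ ≤ L₀ := fun x hx ↦ memL.mpr fun h hh _ ↦ memK.mp hx h hh
  have htL : t ∈ L₀ := memL.mpr fun h _ hht ↦ hht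
  haveI hfinK : FiniteDimensional (v.adicCompletion ℚ) K₀ := finiteDimensional_fixedField_of_isOpen Hn hopenHn
  haveI hfinL : FiniteDimensional (v.adicCompletion ℚ) L₀ := finiteDimensional_fixedField_of_isOpen D hopenD
  have hrkK : Module.finrank (v.adicCompletion ℚ) K₀ = 2 ^ n := by
    rw [hK₀, finrank_fixedField_of_isOpen Hn hopenHn, hidxHn]
  have hrkL : Module.finrank (v.adicCompletion ℚ) L₀ = 2 * 2 ^ n := by
    rw [hL₀, finrank_fixedField_of_isOpen D hopenD, hidxD]
  -- `L₀ / ℚ_v` is Galois (Krull: `D` is open and normal)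
  haveI hGalL : IsGalois (v.adicCompletion ℚ) L₀ := by
    have hfix := fixingSubgroup_fixedField_of_isOpen D hopenD
    have key := fun x ↦ SetLike.ext_iff.mp hfix x
    refine (InfiniteGalois.normal_iff_isGalois _).mp ?_
    exact ⟨fun a ha b ↦ (key _).mpr (hnormD.conj_mem a ((key a).mp ha) b)⟩
  -- `L₀` as a `K₀`-algebra: Galois, of degree `2`, cyclic
  letI : Algebra K₀ L₀ := LocalWeilDatum.towerAlgebra hKL
  haveI : IsScalarTower (v.adicCompletion ℚ) K₀ L₀ := LocalWeilDatum.towerAlgebra_isScalarTower_bot hKL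
  haveI hfinKL : FiniteDimensional K₀ L₀ := LocalWeilDatum.towerAlgebra_finiteDimensional hKL
  haveI hGal : IsGalois K₀ L₀ := IsGalois.tower_top_of_isGalois (v.adicCompletion ℚ) K₀ L₀
  haveI : Module.Free K₀ L₀ := Module.Free.of_divisionRing K₀ L₀
  have hrk : Module.finrank K₀ L₀ = 2 := by
    have h := Module.finrank_mul_finrank (v.adicCompletion ℚ) K₀ L₀
    rw [hrkK, hrkL] at h
    apply Nat.eq_of_mul_eq_mul_left (Nat.pos_of_ne_zero (pow_ne_zero n two_ne_zero))
    rw [h, mul_comm]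
  have hcard : Nat.card (L₀ ≃ₐ[K₀] L₀) = 2 := by rw [IsGalois.card_aut_eq_finrank K₀ L₀, hrk]
  haveI : IsCyclic (L₀ ≃ₐ[K₀] L₀) := isCyclic_of_prime_card hcard
  -- the CLASS FIELD AXIOM `[K₀ˣ : N L₀ˣ] = 2`
  have hidx : (Units.map (Algebra.norm K₀ : L₀ →* K₀)).range.index = 2 := by
    rw [normIndex_eq_finrank_of_isNonarchimedeanLocalField (v.adicCompletion ℚ) K₀ L₀, hrk]
  -- the restriction `τ̄₀ ∈ Gal(L₀/K₀)` of `τ₀` and the norm formula `N(f) = f · τ₀ f`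
  let r : L₀ ≃ₐ[v.adicCompletion ℚ] L₀ :=
    (absoluteGaloisGroup.toAlgEquiv (v.adicCompletion ℚ) τ₀).restrictNormal L₀
  have hr : ∀ x : L₀, ((r x : L₀) : AlgebraicClosure (v.adicCompletion ℚ)) =
      τ₀ • (x : AlgebraicClosure (v.adicCompletion ℚ)) := fun x ↦
    AlgEquiv.restrictNormal_commutes _ L₀ x
  let τ : L₀ ≃ₐ[K₀] L₀ := AlgEquiv.ofRingEquiv (f := r.toRingEquiv) (fun k ↦ by
    apply Subtype.ext
    change ((r (algebraMap K₀ L₀ k) : L₀) : AlgebraicClosure (v.adicCompletion ℚ)) =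
      ((algebraMap K₀ L₀ k : L₀) : AlgebraicClosure (v.adicCompletion ℚ))
    rw [hr, LocalWeilDatum.towerAlgebra_algebraMap_apply]
    exact memK.mp k.2 τ₀ hτ₀)
  have hτ : ∀ x : L₀, ((τ x : L₀) : AlgebraicClosure (v.adicCompletion ℚ)) =
      τ₀ • (x : AlgebraicClosure (v.adicCompletion ℚ)) := fun x ↦ by exact hr x
  have hτ1 : τ ≠ 1 := by
    intro h
    have h1 : ((τ ⟨t, htL⟩ : L₀) : AlgebraicClosure (v.adicCompletion ℚ)) = τ₀ • t := hτ ⟨t, htL⟩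
    rw [h, AlgEquiv.one_apply, hτ₀t] at h1
    exact hne h1.symm
  have hall : ∀ σ : L₀ ≃ₐ[K₀] L₀, σ = 1 ∨ σ = τ := by
    intro σ
    by_contra hσ
    push Not at hσ
    letI : Fintype (L₀ ≃ₐ[K₀] L₀) := Fintype.ofFinite _
    have h3 : ({σ, 1, τ} : Finset (L₀ ≃ₐ[K₀] L₀)).card = 3 := by
      rw [Finset.card_insert_of_notMem (by simp [hσ.1, hσ.2]), Finset.card_pair hτ1.symm]
    have hle := Finset.card_le_univ ({σ, 1, τ} : Finset (L₀ ≃ₐ[K₀] L₀))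
    rw [h3, ← Nat.card_eq_fintype_card, hcard] at hle
    omega
  have hnorm : ∀ f : L₀, ((Algebra.norm K₀ f : K₀) : AlgebraicClosure (v.adicCompletion ℚ)) =
      (f : AlgebraicClosure (v.adicCompletion ℚ)) * τ₀ • (f : AlgebraicClosure (v.adicCompletion ℚ)) := fun f ↦ by
    have h := Algebra.norm_eq_prod_automorphisms K₀ f
    rw [Finset.prod_eq_mul 1 τ hτ1.symm (fun c _ hc ↦ ((hall c).elim hc.1 hc.2).elim)
      (fun h1 ↦ (h1 (Finset.mem_univ _)).elim) (fun h1 ↦ (h1 (Finset.mem_univ _)).elim), AlgEquiv.one_apply] at h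
    have h' : ((Algebra.norm K₀ f : K₀) : AlgebraicClosure (v.adicCompletion ℚ)) =
        ((f * τ f : L₀) : AlgebraicClosure (v.adicCompletion ℚ)) :=
      congrArg (fun y : L₀ ↦ (y : AlgebraicClosure (v.adicCompletion ℚ))) h
    rw [h', MulMemClass.coe_mul, hτ]
  -- pigeonhole in the quotient `K₀ˣ / N L₀ˣ` of order `2`
  set N : Subgroup K₀ˣ := (Units.map (Algebra.norm K₀ : L₀ →* K₀)).range with hN
  have hcardQ : Nat.card (K₀ˣ ⧸ N) = 2 := hidx
  haveI : Finite (K₀ˣ ⧸ N) := Nat.finite_of_card_ne_zero (by rw [hcardQ]; decide)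
  have three : ∀ q₁ q₂ q₃ : K₀ˣ ⧸ N, q₁ = q₂ ∨ q₁ = q₃ ∨ q₂ = q₃ := by
    intro q₁ q₂ q₃
    by_contra hq
    push Not at hq
    obtain ⟨h12, h13, h23⟩ := hq
    letI : Fintype (K₀ˣ ⧸ N) := Fintype.ofFinite _
    have h3 : ({q₁, q₂, q₃} : Finset (K₀ˣ ⧸ N)).card = 3 := by
      rw [Finset.card_insert_of_notMem (by simp [h12, h13]), Finset.card_pair h23]
    have hle := Finset.card_le_univ ({q₁, q₂, q₃} : Finset (K₀ˣ ⧸ N))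
    rw [h3, ← Nat.card_eq_fintype_card, hcardQ] at hle
    omega
  -- units of `K₀` from the `cᵢ`
  have mk : ∀ c : AlgebraicClosure (v.adicCompletion ℚ), c ≠ 0 → (∀ h ∈ Hn, h • c = c) →
      ∃ u : K₀ˣ, ((u : K₀) : AlgebraicClosure (v.adicCompletion ℚ)) = c := fun c hc0 hc ↦
    ⟨Units.mk0 ⟨c, memK.mpr hc⟩ (fun h ↦ hc0 (congrArg Subtype.val h)), rfl⟩
  obtain ⟨u₁, hu₁⟩ := mk c₁ h₁ hc₁
  obtain ⟨u₂, hu₂⟩ := mk c₂ h₂ hc₂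
  obtain ⟨u₃, hu₃⟩ := mk c₃ h₃ hc₃
  -- congruent units differ by a norm `f₀ · τ₀ f₀`, `f₀ ∈ L₀ˣ`
  have key : ∀ {u u' : K₀ˣ}, (QuotientGroup.mk u : K₀ˣ ⧸ N) = QuotientGroup.mk u' →
      ∃ f₀ : AlgebraicClosure (v.adicCompletion ℚ), f₀ ≠ 0 ∧ (∀ h ∈ Hn, h • t = t → h • f₀ = f₀) ∧
        ((u' : K₀) : AlgebraicClosure (v.adicCompletion ℚ)) =
          f₀ * τ₀ • f₀ * ((u : K₀) : AlgebraicClosure (v.adicCompletion ℚ)) := by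
    intro u u' huu
    rw [QuotientGroup.eq, hN, MonoidHom.mem_range] at huu
    obtain ⟨fu, hfu⟩ := huu
    refine ⟨((fu : L₀) : AlgebraicClosure (v.adicCompletion ℚ)), fun h0 ↦ fu.ne_zero (Subtype.ext h0),
      fun h hh hht ↦ memL.mp (fu : L₀).2 h hh hht, ?_⟩
    have h2 : u * Units.map (Algebra.norm K₀ : L₀ →* K₀) fu = u' := by rw [hfu, mul_inv_cancel_left]
    have h3 := congrArg (fun w : K₀ˣ ↦ ((w : K₀) : AlgebraicClosure (v.adicCompletion ℚ))) h2
    simp only [Units.val_mul, Units.coe_map, MulMemClass.coe_mul] at h3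
    rw [hnorm] at h3
    rw [← h3]
    ring
  rcases three (QuotientGroup.mk u₁) (QuotientGroup.mk u₂) (QuotientGroup.mk u₃) with h | h | h
  · obtain ⟨f₀, hf0, hfL, hrel'⟩ := key h.symm
    exact ⟨f₀, hf0, hfL, Or.inl (by rw [← hu₁, ← hu₂]; exact hrel')⟩
  · obtain ⟨f₀, hf0, hfL, hrel'⟩ := key h.symm
    exact ⟨f₀, hf0, hfL, Or.inr (Or.inl (by rw [← hu₁, ← hu₃]; exact hrel'))⟩
  · obtain ⟨f₀, hf0, hfL, hrel'⟩ := key h.symm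
    exact ⟨f₀, hf0, hfL, Or.inr (Or.inr (by rw [← hu₂, ← hu₃]; exact hrel'))⟩

end Summit.BirchSwinnertonDyer.BirchSwinnertonDyer.Theorems.MultTowerNS2

end
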